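import Summits.BirchSwinnertonDyer.BirchSwinnertonDyer.Theorems.ErratumRoadFiveEulerHalfGenusFrameKolyvaginCurrency
import Summits.BirchSwinnertonDyer.BirchSwinnertonDyer.Theorems.ErratumRoadFiveEulerHalfGenusLineSetting
import Summits.BirchSwinnertonDyer.BirchSwinnertonDyer.Theorems.ClassRecordThreeEulerHalvesAtThreeKolyvaginFamilyClassCertificate
import Literature.NumberTheory.EllipticCurves.KummerSelmerStructure
import HarnessLib

/-!
# ErratumRoadFive ∕ EulerHalf ∕ genus line — (b2b-κ) brick: the KUMMER condition of the genus-family classes at the finite places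
# off the level and off `p` (clauses (1)/(4) of `GenusClassDataSupply`, finite part off `p`; helper, `--supports 23444`)

Cell bsd-stepL, prover seat `bsd-stepL-imc-p1` g42; plan `HOME/imc-p1/g42/B2BK-ASSEMBLY-PLAN-imc-p1-g42.md` §3 (1), (4) and F.5 (iii).

WHAT.  On a served frame (`FrameProfile`: `5 ≤ p`, every `ℓ ≠ q` of `N_W` split in `K`, `p` the only multiplicative prime,
`p ∤ ord_q j(W)`), for ANY family datum `d` at a level `m` whose prime factors are Gross–Kolyvagin primes, with admissible
`E(K[m]) ⊆ E(K̄)` and `[P_m]` invariant mod `p^k` (the coherent family package supplies both):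
* `kolyvaginClass_familyData_mem_selmerLocalKer_offP_of_frameProfile` — `c_k(d) ∈ Sel(K_v)` at every finite `v ∤ m·p`, INCLUDING
  `v ∣ q` — A2a's abstract theorem `genusKolyvaginLocalOffP_of_pOnlyMult` (`GenusKolyvaginLocalOffP`, McCallum's class of an invariant
  point relative to a `K[m]`-rational admissible subgroup) instantiated at `d.pointsSubgroup` (rational by
  `KolyvaginFamilyData.smul_toGeomPoints_of_forall_emb`) and `d.derivedPoint`, through `KolyvaginFamilyData.kolyvaginClass_def`.
* `localization_kolyvaginClass_familyData_mem_kummer_offP_of_frameProfile` — the same in the clause's currency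
  `loc_v c_k(d) ∈ kummerSelmerStructure (p^k) (Sum.inr v)` (`comap_localization_kummerSelmerStructure`).
What is NOT here (next bricks): the places over `p` (clause (5) stringent ⟹ Kummer) and the archimedean places.

HONEST FRAMING: helper theorems; no crux and no stub is closed; BSD is proved for no curve.
[cite: GrossLMS1991, Prop. 6.2 (1)] [cite: McCallumLMS1991, §4 (4.6)] [cite: Jetchev2008, §3.4.1]
presearch: in-tree only; no new literature.
-/

set_option autoImplicit false
-- D-0017: single-problem summit, so `Summit.BirchSwinnertonDyer.BirchSwinnertonDyer.…` repeats a namespace BY DESIGN.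
set_option linter.dupNamespace false

noncomputable section

open scoped Classical
open WeierstrassCurve NumberField Field IsDedekindDomain Literature.NumberTheory.EllipticCurves
  Literature.NumberTheory.EllipticCurves.ModularForms Literature.NumberTheory.GaloisRepresentations
  Literature.NumberTheory.GaloisRepresentations.DiscreteGaloisModule Literature.NumberTheory.EllipticCurves.KolyvaginCocycle
  Summit.BirchSwinnertonDyer.Rank1Residual Summit.BirchSwinnertonDyer.Rank1Residual.X11b
  Summit.BirchSwinnertonDyer.Rank1Residual.JET Summit.BirchSwinnertonDyer.Rank1Residual.JET.SelmerVocabulary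

namespace Summit.BirchSwinnertonDyer.BirchSwinnertonDyer.Theorems.GenusLine

variable {W A : WeierstrassCurve ℚ} {p q : ℕ} {K : Type} [Field K] [NumberField K]

/-- **`c_k(d) ∈ Sel(K_v)` at every finite `v ∤ m·p` on a served frame** — see the module docstring.
[cite: GrossLMS1991, Prop. 6.2 (1)] [cite: McCallumLMS1991, §4 (4.6)] -/
theorem kolyvaginClass_familyData_mem_selmerLocalKer_offP_of_frameProfile [W.IsElliptic] [W.IsGloballyMinimal] [A.IsElliptic]
    [Fact p.Prime] [Fact q.Prime]
    (S : GenusHeegnerSettingRC W A p q K) (hprof : FrameProfile W A p q K)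
    {k m : ℕ} (hm : m ≠ 0) (hKol : ∀ r ∈ m.primeFactors, IsKolyvaginPrime (W.conductorNorm ℤ) W K p r)
    (d : KolyvaginFamilyData W K S.ιc m)
    (hA : IsAdmissible (absoluteGaloisGroup K) d.pointsSubgroup ((p ^ k : ℕ) : ℤ))
    (hP : d.toGeomPoints d.derivedPoint ∈ invPoints (absoluteGaloisGroup K) d.pointsSubgroup ((p ^ k : ℕ) : ℤ))
    (v : HeightOneSpectrum (𝓞 K)) (hv : ((m : ℕ) : 𝓞 K) ∉ v.asIdeal) (hvp : ((p : ℕ) : 𝓞 K) ∉ v.asIdeal) :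
    d.kolyvaginClass (Fact.out : p.Prime) k ∈ selmerLocalKer (W.baseChange K) (v.adicCompletion K) ((p ^ k : ℕ) : ℤ) := by
  have hp : p.Prime := Fact.out
  have hK : IsImaginaryQuadratic K := hprof.quad
  rw [d.kolyvaginClass_def hp k, dif_pos ⟨hA, hP⟩]
  -- `E(K[m]) ⊆ E(K̄)` is `K[m]`-rational
  let e : ringClassField K S.ιc m →ₐ[K] AlgebraicClosure K := { d.emb with commutes' := d.emb_apply }
  have hArat : ∀ a ∈ d.pointsSubgroup, ∀ Φ : absoluteGaloisGroup K,
      (∀ x : ringClassField K S.ιc m, Φ • e x = e x) → Φ • a = a := by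
    rintro a ⟨a₀, rfl⟩ Φ hΦ
    exact d.smul_toGeomPoints_of_forall_emb a₀ Φ fun x ↦ hΦ x
  exact genusKolyvaginLocalOffP_of_pOnlyMult W p q K hK S.ιc hprof.five_le hprof.sp hprof.only hprof.jval hm e hKol hA hArat hP
    v hv hvp

/-- **Clause (4) (and the Kummer half of clause (1)) at the finite places off `m·p`, in the clause's currency**:
`loc_v c_k(d) ∈ H¹_Kum(K_v, W[p^k])`. [cite: GrossLMS1991, Prop. 6.2 (1)] [cite: Jetchev2008, §3.4.1] -/
theorem localization_kolyvaginClass_familyData_mem_kummer_offP_of_frameProfile [W.IsElliptic] [W.IsGloballyMinimal]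
    [A.IsElliptic] [Fact p.Prime] [Fact q.Prime]
    (S : GenusHeegnerSettingRC W A p q K) (hprof : FrameProfile W A p q K)
    {k m : ℕ} (hm : m ≠ 0) (hKol : ∀ r ∈ m.primeFactors, IsKolyvaginPrime (W.conductorNorm ℤ) W K p r)
    (d : KolyvaginFamilyData W K S.ιc m)
    (hA : IsAdmissible (absoluteGaloisGroup K) d.pointsSubgroup ((p ^ k : ℕ) : ℤ))
    (hP : d.toGeomPoints d.derivedPoint ∈ invPoints (absoluteGaloisGroup K) d.pointsSubgroup ((p ^ k : ℕ) : ℤ))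
    (v : HeightOneSpectrum (𝓞 K)) (hv : ((m : ℕ) : 𝓞 K) ∉ v.asIdeal) (hvp : ((p : ℕ) : 𝓞 K) ∉ v.asIdeal) :
    galoisCohomology.localization ((W.baseChange K).torsionGaloisModule ((p ^ k : ℕ) : ℤ)) (Sum.inr v) 1
        (d.kolyvaginClass (Fact.out : p.Prime) k) ∈
      (W.baseChange K).kummerSelmerStructure ((p ^ k : ℕ) : ℤ) (Sum.inr v) := by
  haveI : (W.baseChange K).IsElliptic := by unfold WeierstrassCurve.baseChange; infer_instance
  have hsel := kolyvaginClass_familyData_mem_selmerLocalKer_offP_of_frameProfile S hprof hm hKol d hA hP v hv hvp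
  have h' : d.kolyvaginClass (Fact.out : p.Prime) k ∈
      ((W.baseChange K).kummerSelmerStructure ((p ^ k : ℕ) : ℤ) (Sum.inr v)).comap
        (galoisCohomology.localization ((W.baseChange K).torsionGaloisModule ((p ^ k : ℕ) : ℤ)) (Sum.inr v) 1) := by
    rw [(W.baseChange K).comap_localization_kummerSelmerStructure]; exact hsel
  exact AddSubgroup.mem_comap.mp h'

end Summit.BirchSwinnertonDyer.BirchSwinnertonDyer.Theorems.GenusLine

end
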